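import Mathlib.Analysis.InnerProductSpace.l2Space
import Mathlib.MeasureTheory.Function.L2Space
import Mathlib.MeasureTheory.Integral.Prod
import HarnessLib

/-!
# Hilbert bases of `L²` of a product measure from Hilbert bases of the factors

Analysis/FunctionSpaces support file (measure theory + Hilbert-space bookkeeping; no named facts).

For s-finite measures `μ` on `α` and `ν` on `β` and an `RCLike` scalar field `𝕜`:

* `tensorLp f g` — the elementary tensor `(x, y) ↦ f x * g y` of `f ∈ L²(μ)`, `g ∈ L²(ν)` as an
  element of `L²(μ.prod ν)` (`memLp_two_tensor`), with `⟪f ⊗ g, f' ⊗ g'⟫ = ⟪f, f'⟫ ⟪g, g'⟫`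
  (`inner_tensorLp_tensorLp`) and the Fubini formula
  `⟪f ⊗ g, h⟫ = ∫ conj f(x) (∫ conj g(y) h(x, y) dν) dμ` (`inner_tensorLp_left`).
* `fibredTensorBasis b c` — **the fibred product basis**: if `c = (c_j)_{j ∈ J}` is a Hilbert
  basis of `L²(ν)` with `J` countable and, for every `j`, `b j = (b_{j,i})_{i ∈ ι j}` is a Hilbert
  basis of `L²(μ)` (allowed to depend on `j`), then `(b_{j,i} ⊗ c_j)_{(j,i)}` is a Hilbert basis of
  `L²(μ.prod ν)`; `fibredTensorBasis_apply`, `fibredTensorBasis_repr` (the coefficients are the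
  iterated integrals). This is the form needed for separation of variables in which the basis in
  the first variable depends on the quantum number of the second (e.g. spheroidal/spherical
  harmonics `S_{mℓ}(cos θ) e^{imφ}` on `L²([-1,1] × 𝕋) ≅ L²(S²)`).
* `tensorBasis b c` — the special case of a fixed basis `b` of `L²(μ)`: `(b_i ⊗ c_j)_{(i,j)}` is a
  Hilbert basis of `L²(μ.prod ν)` (`tensorBasis_apply`).

Proof of completeness (`eq_zero_of_forall_inner_tensorLp`): if `h ⊥ b_{j,i} ⊗ c_j` for all
`j, i`, then for each `j` the partial pairing `G_j(x) = ∫ conj c_j(y) h(x, y) dν(y)` is in `L²(μ)`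
(Cauchy–Schwarz in `y` and Tonelli, `memLp_two_secPair`) and has vanishing `b j`-coefficients,
so `G_j = 0` a.e.; `J` being countable, for a.e. `x` the section `h(x, ·) ∈ L²(ν)` is orthogonal
to every `c_j`, hence vanishes, and `h = 0` by Tonelli.

-- TODO(general form): completeness holds without the countability of `J` (density of finite
-- sums of indicators of measurable rectangles in `L²(μ.prod ν)`); only the countable case is
-- needed downstream (all Hilbert bases of a separable `L²` are countable).

## Mathlib / tree search

Mathlib (this pin) has `HilbertBasis`, `HilbertBasis.mkOfOrthogonalEqBot`, the Fourier Hilbert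
bases `fourierBasis` / `UnitAddTorus.mFourierBasis`, Fubini–Tonelli (`integral_prod`,
`lintegral_prod`, `integral_prod_mul`, `Integrable.mul_prod`) and the algebraic Hilbert tensor
product (`Analysis/InnerProductSpace/TensorProduct`), but no statement producing a Hilbert basis
of `Lp 𝕜 2 (μ.prod ν)` from bases of the factors (searched `HilbertBasis.*prod`,
`prod.*HilbertBasis`, `tensor.*Lp`, `Orthonormal.*prod`). The tree has the parametrised
Riesz–Fischer file `FunctionSpaces/TorusRieszFischerParam.lean` (elementary tensors
`c(t) e_k(x)` in `L²(μ ⊗ dx)`), which is about a different question (joint measurability).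

## References

* M. Reed, B. Simon, *Methods of Modern Mathematical Physics I: Functional Analysis*, revised
  and enlarged ed. (Academic Press 1980), §II.4, PDF p. 51 (the paragraph preceding Theorem II.10,
  PDF p. 52): if `{φ_k(x)}` and `{ψ_l(y)}` are bases of `L²(M₁, dμ₁)` and `L²(M₂, dμ₂)` then
  `{φ_k(x) ψ_l(y)}` is a basis of `L²(M₁ × M₂, dμ₁ ⊗ dμ₂)`; the proof printed there (Fubini,
  sections, the countable union of null sets `⋃ S_k`) is the one formalised here, with the roles
  of the two variables exchanged and the first-variable basis allowed to depend on the second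
  index. [ReedSimonI1980]
-/

open MeasureTheory Set Filter Topology Function Submodule
open scoped ENNReal NNReal ComplexConjugate InnerProductSpace

noncomputable section

namespace Literature.Analysis.FunctionSpaces

variable {α β : Type*} [MeasurableSpace α] [MeasurableSpace β] {μ : Measure α} {ν : Measure β}
  {𝕜 : Type*} [RCLike 𝕜]

section General

variable {γ : Type*} [MeasurableSpace γ] {ρ : Measure γ}

/-- An `L²` class has integrable squared norm. [folklore] -/
theorem integrable_sq_norm_Lp (h : Lp 𝕜 2 ρ) : Integrable (fun z ↦ ‖h z‖ ^ 2) ρ :=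
  (memLp_two_iff_integrable_sq_norm (Lp.memLp h).1).1 (Lp.memLp h)

/-- `‖u‖² = ∫ ‖u‖²` for `u ∈ L²`. [folklore] -/
theorem norm_sq_eq_integral_Lp_two (u : Lp 𝕜 2 ρ) : ‖u‖ ^ 2 = ∫ y, ‖u y‖ ^ 2 ∂ρ := by
  have h1 : ⟪u, u⟫_𝕜 = ((‖u‖ ^ 2 : ℝ) : 𝕜) := by
    rw [inner_self_eq_norm_sq_to_K]; norm_cast
  have h2 : ⟪u, u⟫_𝕜 = ((∫ y, ‖u y‖ ^ 2 ∂ρ : ℝ) : 𝕜) := by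
    rw [L2.inner_def, ← integral_ofReal]
    refine integral_congr_ae (ae_of_all _ fun y ↦ ?_)
    beta_reduce
    rw [inner_self_eq_norm_sq_to_K]
    norm_cast
  exact_mod_cast RCLike.ofReal_injective (h1.symm.trans h2)

/-- The inner product of `L²(ρ)` against a represented class. [folklore] -/
theorem inner_toLp_right_eq_integral (g : Lp 𝕜 2 ρ) {u : γ → 𝕜} (hu : MemLp u 2 ρ) :
    ⟪g, hu.toLp u⟫_𝕜 = ∫ y, conj (g y) * u y ∂ρ := by
  rw [L2.inner_def]
  refine integral_congr_ae ?_
  filter_upwards [hu.coeFn_toLp] with y hy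
  rw [RCLike.inner_apply, hy, mul_comm]

/-- An element of a Hilbert space all of whose coefficients in a Hilbert basis vanish is zero.
[folklore] -/
theorem eq_zero_of_forall_inner_hilbertBasis {ι E : Type*} [NormedAddCommGroup E]
    [InnerProductSpace 𝕜 E] [CompleteSpace E] (b : HilbertBasis ι 𝕜 E) {x : E}
    (hx : ∀ i, ⟪b i, x⟫_𝕜 = 0) : x = 0 := by
  have hrepr : b.repr x = 0 := by
    refine lp.ext (funext fun i ↦ ?_)
    rw [HilbertBasis.repr_apply_apply, hx]
    rfl
  exact b.repr.injective (hrepr.trans (map_zero _).symm)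

end General

section Tensor

/-- The elementary tensor of two square-integrable functions is square integrable for the
product measure. [folklore] -/
theorem memLp_two_tensor (f : Lp 𝕜 2 μ) (g : Lp 𝕜 2 ν) :
    MemLp (fun z : α × β ↦ f z.1 * g z.2) 2 (μ.prod ν) := by
  have hmeas : AEStronglyMeasurable (fun z : α × β ↦ f z.1 * g z.2) (μ.prod ν) :=
    (Lp.memLp f).1.comp_fst.mul (Lp.memLp g).1.comp_snd
  rw [memLp_two_iff_integrable_sq_norm hmeas]
  refine ((integrable_sq_norm_Lp f).mul_prod (integrable_sq_norm_Lp g)).congr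
    (ae_of_all _ fun z ↦ ?_)
  simp only [norm_mul, mul_pow]

/-- **Elementary tensor** `f ⊗ g : (x, y) ↦ f x * g y` in `L²(μ.prod ν)` of `f ∈ L²(μ)` and
`g ∈ L²(ν)`. [folklore] -/
def tensorLp (f : Lp 𝕜 2 μ) (g : Lp 𝕜 2 ν) : Lp 𝕜 2 (μ.prod ν) :=
  (memLp_two_tensor f g).toLp _

/-- Pointwise a.e. formula for the elementary tensor. [folklore] -/
theorem coeFn_tensorLp (f : Lp 𝕜 2 μ) (g : Lp 𝕜 2 ν) :
    tensorLp f g =ᵐ[μ.prod ν] fun z ↦ f z.1 * g z.2 :=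
  MemLp.coeFn_toLp _

variable [SFinite μ] [SFinite ν]

/-- `⟪f ⊗ g, f' ⊗ g'⟫ = ⟪f, f'⟫ ⟪g, g'⟫` (Fubini). [folklore] -/
theorem inner_tensorLp_tensorLp (f f' : Lp 𝕜 2 μ) (g g' : Lp 𝕜 2 ν) :
    ⟪tensorLp f g, tensorLp f' g'⟫_𝕜 = ⟪f, f'⟫_𝕜 * ⟪g, g'⟫_𝕜 := by
  simp only [L2.inner_def]
  rw [← integral_prod_mul]
  refine integral_congr_ae ?_
  filter_upwards [coeFn_tensorLp f g, coeFn_tensorLp f' g'] with z hz hz'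
  rw [RCLike.inner_apply, RCLike.inner_apply, RCLike.inner_apply, hz, hz', map_mul]
  ring

omit [SFinite μ] [SFinite ν] in
/-- Integrability of `conj f(x) (conj g(y) h(x, y))` on the product for `L²` data. [folklore] -/
theorem integrable_conj_tensor_mul (f : Lp 𝕜 2 μ) (g : Lp 𝕜 2 ν) (h : Lp 𝕜 2 (μ.prod ν)) :
    Integrable (fun z : α × β ↦ conj (f z.1) * (conj (g z.2) * h z)) (μ.prod ν) := by
  refine (L2.integrable_inner (𝕜 := 𝕜) (tensorLp f g) h).congr ?_
  filter_upwards [coeFn_tensorLp f g] with z hz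
  rw [RCLike.inner_apply, hz, map_mul]
  ring

/-- **Fubini for the pairing with an elementary tensor**:
`⟪f ⊗ g, h⟫ = ∫ conj f(x) (∫ conj g(y) h(x, y) dν(y)) dμ(x)`. [folklore] -/
theorem inner_tensorLp_left (f : Lp 𝕜 2 μ) (g : Lp 𝕜 2 ν) (h : Lp 𝕜 2 (μ.prod ν)) :
    ⟪tensorLp f g, h⟫_𝕜 = ∫ x, conj (f x) * ∫ y, conj (g y) * h (x, y) ∂ν ∂μ := by
  rw [L2.inner_def]
  calc ∫ z, ⟪(tensorLp f g) z, h z⟫_𝕜 ∂μ.prod ν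
      = ∫ z, conj (f z.1) * (conj (g z.2) * h z) ∂μ.prod ν := by
        refine integral_congr_ae ?_
        filter_upwards [coeFn_tensorLp f g] with z hz
        rw [RCLike.inner_apply, hz, map_mul]
        ring
    _ = ∫ x, ∫ y, conj (f x) * (conj (g y) * h (x, y)) ∂ν ∂μ :=
        integral_prod _ (integrable_conj_tensor_mul f g h)
    _ = ∫ x, conj (f x) * ∫ y, conj (g y) * h (x, y) ∂ν ∂μ := by
        refine integral_congr_ae (ae_of_all _ fun x ↦ ?_)
        exact integral_const_mul _ _

variable {J : Type*} {ι : J → Type*}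

/-- **Orthonormality of fibred elementary tensors**: if `w` is orthonormal in `L²(ν)` and each
`v j` is orthonormal in `L²(μ)`, then `(v j i ⊗ w j)_{(j,i)}` is orthonormal in `L²(μ.prod ν)`.
[folklore] -/
theorem orthonormal_fibredTensor {v : ∀ j, ι j → Lp 𝕜 2 μ} {w : J → Lp 𝕜 2 ν}
    (hv : ∀ j, Orthonormal 𝕜 (v j)) (hw : Orthonormal 𝕜 w) :
    Orthonormal 𝕜 (fun p : (Σ j, ι j) ↦ tensorLp (v p.1 p.2) (w p.1)) := by
  classical
  rw [orthonormal_iff_ite]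
  rintro ⟨j, i⟩ ⟨j', i'⟩
  rw [inner_tensorLp_tensorLp]
  by_cases hj : j = j'
  · subst hj
    rw [orthonormal_iff_ite.1 hw, if_pos rfl, mul_one, orthonormal_iff_ite.1 (hv j)]
    by_cases hi : i = i'
    · subst hi
      rw [if_pos rfl, if_pos rfl]
    · rw [if_neg hi, if_neg]
      intro h
      exact hi (eq_of_heq (Sigma.mk.inj_iff.1 h).2)
  · rw [orthonormal_iff_ite.1 hw, if_neg hj, mul_zero, if_neg]
    exact fun h ↦ hj (congrArg Sigma.fst h)

end Tensor

variable [SFinite μ] [SFinite ν]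

section Sections

/-- Almost every section of an `L²` function on a product is in `L²`. [folklore] -/
theorem ae_memLp_two_section (h : Lp 𝕜 2 (μ.prod ν)) :
    ∀ᵐ x ∂μ, MemLp (fun y ↦ h (x, y)) 2 ν := by
  filter_upwards [(integrable_sq_norm_Lp h).prod_right_ae, (Lp.memLp h).1.prodMk_left]
    with x hx hmeas
  exact (memLp_two_iff_integrable_sq_norm hmeas).2 hx

/-- The **partial pairing** `x ↦ ∫ conj g(y) h(x, y) dν(y)` of `h ∈ L²(μ.prod ν)` against
`g ∈ L²(ν)` in the second variable. [folklore] -/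
def secPair (g : Lp 𝕜 2 ν) (h : Lp 𝕜 2 (μ.prod ν)) : α → 𝕜 :=
  fun x ↦ ∫ y, conj (g y) * h (x, y) ∂ν

omit [SFinite μ] [SFinite ν] in
/-- Unfolding lemma for `secPair`. [folklore] -/
theorem secPair_apply (g : Lp 𝕜 2 ν) (h : Lp 𝕜 2 (μ.prod ν)) (x : α) :
    secPair g h x = ∫ y, conj (g y) * h (x, y) ∂ν := rfl

omit [SFinite μ] in
/-- The partial pairing is a.e. strongly measurable (measurability half of Fubini). [folklore] -/
theorem aestronglyMeasurable_secPair (g : Lp 𝕜 2 ν) (h : Lp 𝕜 2 (μ.prod ν)) :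
    AEStronglyMeasurable (secPair (μ := μ) g h) μ := by
  have hmeas : AEStronglyMeasurable (fun z : α × β ↦ conj (g z.2) * h z) (μ.prod ν) :=
    (RCLike.continuous_conj.comp_aestronglyMeasurable (Lp.memLp g).1.comp_snd).mul (Lp.memLp h).1
  exact hmeas.integral_prod_right'

omit [SFinite μ] [SFinite ν] in
/-- On an `L²` section the partial pairing is the `L²(ν)` inner product. [folklore] -/
theorem secPair_eq_inner (g : Lp 𝕜 2 ν) (h : Lp 𝕜 2 (μ.prod ν)) {x : α}
    (hx : MemLp (fun y ↦ h (x, y)) 2 ν) : secPair g h x = ⟪g, hx.toLp _⟫_𝕜 := by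
  rw [inner_toLp_right_eq_integral]
  rfl

/-- **Cauchy–Schwarz for the partial pairing**: `|∫ conj g(y) h(x,y) dν| ≤ ‖g‖ (∫ |h(x,·)|²)^{1/2}`
for a.e. `x`. [folklore] -/
theorem norm_secPair_le (g : Lp 𝕜 2 ν) (h : Lp 𝕜 2 (μ.prod ν)) :
    ∀ᵐ x ∂μ, ‖secPair g h x‖ ≤ ‖g‖ * Real.sqrt (∫ y, ‖h (x, y)‖ ^ 2 ∂ν) := by
  filter_upwards [ae_memLp_two_section h] with x hx
  have hn : ‖hx.toLp _‖ = Real.sqrt (∫ y, ‖h (x, y)‖ ^ 2 ∂ν) := by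
    rw [← Real.sqrt_sq (norm_nonneg _), norm_sq_eq_integral_Lp_two]
    congr 1
    refine integral_congr_ae ?_
    filter_upwards [hx.coeFn_toLp] with y hy
    rw [hy]
  rw [secPair_eq_inner g h hx, ← hn]
  exact norm_inner_le_norm _ _

/-- **The partial pairing of `L²` data is in `L²(μ)`** (Cauchy–Schwarz and Tonelli). [folklore] -/
theorem memLp_two_secPair (g : Lp 𝕜 2 ν) (h : Lp 𝕜 2 (μ.prod ν)) :
    MemLp (secPair (μ := μ) g h) 2 μ := by
  have hΦ : Integrable (fun x ↦ ∫ y, ‖h (x, y)‖ ^ 2 ∂ν) μ :=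
    (integrable_sq_norm_Lp h).integral_prod_left
  have hG : MemLp (fun x ↦ ‖g‖ * Real.sqrt (∫ y, ‖h (x, y)‖ ^ 2 ∂ν)) 2 μ := by
    refine MemLp.const_mul ?_ _
    rw [memLp_two_iff_integrable_sq_norm
      (Real.continuous_sqrt.comp_aestronglyMeasurable hΦ.1)]
    refine hΦ.congr (ae_of_all _ fun x ↦ ?_)
    beta_reduce
    rw [Real.norm_eq_abs, sq_abs, Real.sq_sqrt (integral_nonneg fun y ↦ by positivity)]
  refine hG.of_le (aestronglyMeasurable_secPair g h) ?_
  filter_upwards [norm_secPair_le g h] with x hx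
  rw [Real.norm_of_nonneg (by positivity)]
  exact hx

/-- The `L²(μ)` class of the partial pairing. [folklore] -/
def secPairLp (g : Lp 𝕜 2 ν) (h : Lp 𝕜 2 (μ.prod ν)) : Lp 𝕜 2 μ :=
  (memLp_two_secPair g h).toLp _

/-- Pointwise a.e. formula for `secPairLp`. [folklore] -/
theorem coeFn_secPairLp (g : Lp 𝕜 2 ν) (h : Lp 𝕜 2 (μ.prod ν)) :
    secPairLp (μ := μ) g h =ᵐ[μ] secPair g h :=
  MemLp.coeFn_toLp _

/-- `⟪f, G⟫_{L²(μ)} = ⟪f ⊗ g, h⟫_{L²(μ × ν)}` for the partial pairing `G = secPairLp g h`.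
[folklore] -/
theorem inner_secPairLp (f : Lp 𝕜 2 μ) (g : Lp 𝕜 2 ν) (h : Lp 𝕜 2 (μ.prod ν)) :
    ⟪f, secPairLp g h⟫_𝕜 = ⟪tensorLp f g, h⟫_𝕜 := by
  rw [inner_tensorLp_left, secPairLp, inner_toLp_right_eq_integral]
  rfl

end Sections

section Completeness

variable {J : Type*} {ι : J → Type*}

/-- **Completeness of fibred elementary tensors**: an `h ∈ L²(μ.prod ν)` orthogonal to all
`b j i ⊗ c j` (`c` a Hilbert basis of `L²(ν)` with countable index set, each `b j` a Hilbert basis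
of `L²(μ)`) vanishes.
[cite: ReedSimonI1980, §II.4, PDF p. 51 (basis of L²(M₁ × M₂), preceding Thm II.10)] -/
theorem eq_zero_of_forall_inner_tensorLp [Countable J]
    (b : ∀ j, HilbertBasis (ι j) 𝕜 (Lp 𝕜 2 μ)) (c : HilbertBasis J 𝕜 (Lp 𝕜 2 ν))
    (h : Lp 𝕜 2 (μ.prod ν)) (horth : ∀ j i, ⟪tensorLp (b j i) (c j), h⟫_𝕜 = 0) : h = 0 := by
  -- Step 1: every partial pairing `G_j` vanishes in `L²(μ)`.
  have h1 : ∀ j, secPairLp (μ := μ) (c j) h = 0 := fun j ↦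
    eq_zero_of_forall_inner_hilbertBasis (b j) fun i ↦ by rw [inner_secPairLp, horth]
  -- Step 2: for a.e. `x`, all partial pairings vanish at `x`.
  have h2 : ∀ᵐ x ∂μ, ∀ j, secPair (c j) h x = 0 := by
    rw [ae_all_iff]
    intro j
    have hc := coeFn_secPairLp (μ := μ) (c j) h
    rw [h1 j] at hc
    filter_upwards [hc, Lp.coeFn_zero 𝕜 2 μ] with x hx h0
    rw [← hx, h0, Pi.zero_apply]
  -- Step 3: for a.e. `x`, the section `h (x, ·)` vanishes a.e.
  have h3 : ∀ᵐ x ∂μ, (fun y ↦ h (x, y)) =ᵐ[ν] 0 := by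
    filter_upwards [h2, ae_memLp_two_section h] with x hx hmem
    have hu : hmem.toLp _ = 0 :=
      eq_zero_of_forall_inner_hilbertBasis c fun j ↦ by rw [← secPair_eq_inner (c j) h hmem, hx j]
    have hc := hmem.coeFn_toLp
    rw [hu] at hc
    filter_upwards [hc, Lp.coeFn_zero 𝕜 2 ν] with y hy h0
    rw [← hy, h0]
  -- Step 4: Tonelli.
  have hmeas : AEMeasurable (fun z ↦ ‖h z‖ₑ) (μ.prod ν) := (Lp.memLp h).1.enorm
  have hlin : ∫⁻ z, ‖h z‖ₑ ∂μ.prod ν = 0 := by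
    rw [lintegral_prod _ hmeas]
    refine (lintegral_congr_ae ?_).trans lintegral_zero
    filter_upwards [h3] with x hx
    refine (lintegral_congr_ae ?_).trans lintegral_zero
    filter_upwards [hx] with y hy
    rw [hy, Pi.zero_apply, enorm_zero]
  rw [Lp.eq_zero_iff_ae_eq_zero]
  filter_upwards [(lintegral_eq_zero_iff' hmeas).1 hlin] with z hz
  simpa using hz

/-- The span of the fibred elementary tensors has trivial orthogonal complement.
[cite: ReedSimonI1980, §II.4, PDF p. 51 (basis of L²(M₁ × M₂), preceding Thm II.10)] -/
theorem span_fibredTensor_orthogonal_eq_bot [Countable J]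
    (b : ∀ j, HilbertBasis (ι j) 𝕜 (Lp 𝕜 2 μ)) (c : HilbertBasis J 𝕜 (Lp 𝕜 2 ν)) :
    (span 𝕜 (Set.range fun p : (Σ j, ι j) ↦ tensorLp (b p.1 p.2) (c p.1)))ᗮ = ⊥ := by
  rw [Submodule.eq_bot_iff]
  intro h hh
  refine eq_zero_of_forall_inner_tensorLp b c h fun j i ↦ ?_
  exact (Submodule.mem_orthogonal _ _).1 hh _ (Submodule.subset_span ⟨⟨j, i⟩, rfl⟩)

/-- **Fibred product Hilbert basis of `L²(μ × ν)`**: for a Hilbert basis `c` of `L²(ν)` indexed by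
a countable `J` and, for each `j`, a Hilbert basis `b j` of `L²(μ)`, the elementary tensors
`b j i ⊗ c j`, `(j, i) ∈ Σ j, ι j`, form a Hilbert basis of `L²(μ.prod ν)`.
[cite: ReedSimonI1980, §II.4, PDF p. 51 (basis of L²(M₁ × M₂), preceding Thm II.10)] -/
def fibredTensorBasis [Countable J]
    (b : ∀ j, HilbertBasis (ι j) 𝕜 (Lp 𝕜 2 μ)) (c : HilbertBasis J 𝕜 (Lp 𝕜 2 ν)) :
    HilbertBasis (Σ j, ι j) 𝕜 (Lp 𝕜 2 (μ.prod ν)) :=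
  HilbertBasis.mkOfOrthogonalEqBot
    (orthonormal_fibredTensor (fun j ↦ (b j).orthonormal) c.orthonormal)
    (span_fibredTensor_orthogonal_eq_bot b c)

/-- The fibred product basis consists of the elementary tensors. [folklore] -/
theorem coe_fibredTensorBasis [Countable J]
    (b : ∀ j, HilbertBasis (ι j) 𝕜 (Lp 𝕜 2 μ)) (c : HilbertBasis J 𝕜 (Lp 𝕜 2 ν)) :
    ⇑(fibredTensorBasis b c) = fun p : (Σ j, ι j) ↦ tensorLp (b p.1 p.2) (c p.1) :=
  HilbertBasis.coe_mkOfOrthogonalEqBot _ _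

/-- The fibred product basis at `⟨j, i⟩` is `b j i ⊗ c j`. [folklore] -/
theorem fibredTensorBasis_apply [Countable J]
    (b : ∀ j, HilbertBasis (ι j) 𝕜 (Lp 𝕜 2 μ)) (c : HilbertBasis J 𝕜 (Lp 𝕜 2 ν))
    (p : Σ j, ι j) : fibredTensorBasis b c p = tensorLp (b p.1 p.2) (c p.1) := by
  rw [coe_fibredTensorBasis]

/-- **Coefficients in the fibred product basis are iterated integrals**:
`⟪b j i ⊗ c j, h⟫ = ∫ conj (b j i)(x) (∫ conj (c j)(y) h(x, y) dν) dμ`. [folklore] -/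
theorem fibredTensorBasis_repr [Countable J]
    (b : ∀ j, HilbertBasis (ι j) 𝕜 (Lp 𝕜 2 μ)) (c : HilbertBasis J 𝕜 (Lp 𝕜 2 ν))
    (h : Lp 𝕜 2 (μ.prod ν)) (p : Σ j, ι j) :
    (fibredTensorBasis b c).repr h p =
      ∫ x, conj (b p.1 p.2 x) * ∫ y, conj (c p.1 y) * h (x, y) ∂ν ∂μ := by
  rw [HilbertBasis.repr_apply_apply, fibredTensorBasis_apply, inner_tensorLp_left]

/-- **Parseval for the fibred product basis**: `‖h‖² = ∑_{(j,i)} |⟪b j i ⊗ c j, h⟫|²`. [folklore] -/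
theorem hasSum_sq_norm_inner_fibredTensor [Countable J]
    (b : ∀ j, HilbertBasis (ι j) 𝕜 (Lp 𝕜 2 μ)) (c : HilbertBasis J 𝕜 (Lp 𝕜 2 ν))
    (h : Lp 𝕜 2 (μ.prod ν)) :
    HasSum (fun p : (Σ j, ι j) ↦ ‖⟪tensorLp (b p.1 p.2) (c p.1), h⟫_𝕜‖ ^ 2) (‖h‖ ^ 2) := by
  have H := (fibredTensorBasis b c).hasSum_inner_mul_inner h h
  have hfun : (fun p : (Σ j, ι j) ↦ ⟪h, fibredTensorBasis b c p⟫_𝕜 *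
      ⟪fibredTensorBasis b c p, h⟫_𝕜) =
      fun p ↦ ((‖⟪tensorLp (b p.1 p.2) (c p.1), h⟫_𝕜‖ ^ 2 : ℝ) : 𝕜) := by
    funext p
    rw [fibredTensorBasis_apply, ← inner_conj_symm h, RCLike.conj_mul, RCLike.ofReal_pow]
  rw [hfun, inner_self_eq_norm_sq_to_K] at H
  exact_mod_cast (RCLike.hasSum_ofReal (𝕜 := 𝕜)).1 (by exact_mod_cast H)

end Completeness

section Product

variable {ι J : Type*}

/-- **Product Hilbert basis of `L²(μ × ν)`**: for Hilbert bases `b` of `L²(μ)` and `c` of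
`L²(ν)` (with `J` countable), the elementary tensors `b i ⊗ c j` form a Hilbert basis of
`L²(μ.prod ν)` indexed by `ι × J`.
[cite: ReedSimonI1980, §II.4, PDF p. 51 (basis of L²(M₁ × M₂), preceding Thm II.10)] -/
def tensorBasis [Countable J] (b : HilbertBasis ι 𝕜 (Lp 𝕜 2 μ))
    (c : HilbertBasis J 𝕜 (Lp 𝕜 2 ν)) : HilbertBasis (ι × J) 𝕜 (Lp 𝕜 2 (μ.prod ν)) :=
  HilbertBasis.mkOfOrthogonalEqBot (v := fun p : ι × J ↦ tensorLp (b p.1) (c p.2))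
    (by
      have H := (orthonormal_fibredTensor (fun _ : J ↦ b.orthonormal) c.orthonormal).comp
        _ ((Equiv.sigmaEquivProd J ι).trans (Equiv.prodComm J ι)).symm.injective
      rwa [show ((fun p : (Σ _ : J, ι) ↦ tensorLp (b p.2) (c p.1)) ∘
          ⇑((Equiv.sigmaEquivProd J ι).trans (Equiv.prodComm J ι)).symm) =
          fun p : ι × J ↦ tensorLp (b p.1) (c p.2) from funext fun _ ↦ rfl] at H)
    (by
      have H := span_fibredTensor_orthogonal_eq_bot (fun _ : J ↦ b) c
      have hr : (Set.range fun p : ι × J ↦ tensorLp (b p.1) (c p.2)) =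
          Set.range (fun p : (Σ _ : J, ι) ↦ tensorLp (b p.2) (c p.1)) := by
        ext u
        constructor
        · rintro ⟨⟨i, j⟩, rfl⟩
          exact ⟨⟨j, i⟩, rfl⟩
        · rintro ⟨⟨j, i⟩, rfl⟩
          exact ⟨⟨i, j⟩, rfl⟩
      rw [hr]
      exact H)

/-- The product basis consists of the elementary tensors. [folklore] -/
theorem coe_tensorBasis [Countable J] (b : HilbertBasis ι 𝕜 (Lp 𝕜 2 μ))
    (c : HilbertBasis J 𝕜 (Lp 𝕜 2 ν)) :
    ⇑(tensorBasis b c) = fun p : ι × J ↦ tensorLp (b p.1) (c p.2) :=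
  HilbertBasis.coe_mkOfOrthogonalEqBot _ _

/-- The product basis at `(i, j)` is `b i ⊗ c j`. [folklore] -/
theorem tensorBasis_apply [Countable J] (b : HilbertBasis ι 𝕜 (Lp 𝕜 2 μ))
    (c : HilbertBasis J 𝕜 (Lp 𝕜 2 ν)) (i : ι) (j : J) :
    tensorBasis b c (i, j) = tensorLp (b i) (c j) := by
  rw [coe_tensorBasis]

/-- Coefficients in the product basis are iterated integrals. [folklore] -/
theorem tensorBasis_repr [Countable J] (b : HilbertBasis ι 𝕜 (Lp 𝕜 2 μ))
    (c : HilbertBasis J 𝕜 (Lp 𝕜 2 ν)) (h : Lp 𝕜 2 (μ.prod ν)) (i : ι) (j : J) :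
    (tensorBasis b c).repr h (i, j) =
      ∫ x, conj (b i x) * ∫ y, conj (c j y) * h (x, y) ∂ν ∂μ := by
  rw [HilbertBasis.repr_apply_apply, tensorBasis_apply, inner_tensorLp_left]

end Product

end Literature.Analysis.FunctionSpaces
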